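import Literature.NumberTheory.QuadraticFields.RedeiMatrixFourRank
import HarnessLib

/-!
# Li–Liu–Tian 2024, Thm. 1.2 on a UNIFORM two-prime family: `n = pq`, `p ≡ 1`, `q ≡ 5 (mod 8)`, `(p/q) = −1`

Topic `NumberTheory/EllipticCurves`, namespace `Literature.NumberTheory.EllipticCurves.LiLiuTian2024.RedeiFamilies`
(sibling of `LiLiuTian2024/CongruentNumberFullBSD.lean`).  Everything here is PROVED (no definition, no named fact):
the Rédei matrix of `ℚ(√−pq)` is evaluated UNIFORMLY in the primes, and the two named facts already in the tree —
Rédei–Reichardt (`RedeiReichardt.redeiReichardt_fourTwoCard_classGroup`, p319707) and Li–Liu–Tian 2024 Thm. 1.2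
(`LiLiuTian2024.thm12_bsd_congruentNumberCurve`) — are carried as explicit hypotheses.

* `redeiMatrix_two_p_q_of_jacobiSym_eq_neg_one` / `_eq_one` — for primes `p ≡ 1 (mod 8)`, `q ≡ 5 (mod 8)`
  (`D = disc ℚ(√−pq) = −4pq = (−4)·p·q`, `t = 3`), Li–Ma's `RM(D)` on the prime tuple `(2, p, q)` is
  `[[1,0,1],[0,1,1],[0,1,1]]` if `(p/q) = −1` and `[[1,0,1],[0,0,0],[0,0,0]]` if `(p/q) = +1`
  (rows: `(p/2) = +1`, `(q/2) = −1`; `(−4/p) = (−4/q) = +1`; `(q/p) = (p/q)` by reciprocity);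
* `card_ker_redeiMatrix_two_p_q_*` — its kernel has `2` resp. `4` elements, i.e. `r₄(Cl(ℚ(√−pq))) = 0` resp. `1`
  modulo Rédei–Reichardt: **`(p/q) = −1 ⟺ ℚ(√−pq)` has no ideal class of order `4`** on this family
  (`noIdealClassOfOrderFour_neg_p_mul_q`; and `fourTwoCard_eq_two_neg_p_mul_q` for `(p/q) = +1`);
* `bsd_congruentNumberCurve_p_mul_q`, `forall_bsdp_congruentNumberCurve_p_mul_q` — hence, modulo the two facts,
  `E_{pq} : y² = x³ − (pq)²x` has Mordell–Weil rank `1 =` analytic rank and satisfies `BSD(E_{pq}, ℓ)` for EVERY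
  prime `ℓ`, for EVERY pair of primes `p ≡ 1 (mod 8)`, `q ≡ 5 (mod 8)` with `(p/q) = −1` — a rank-ONE family,
  uniform in the primes (no census number used).

The criterion `(p/q) = −1 ⟺ r₄ = 0` for `D = −4pq` is a direct evaluation of the printed theorem (Li–Ma 2008 Thm. 0.4);
it is not quoted from a printed list (Li–Liu–Tian state Thm. 1.2 with the class-group hypothesis only) and is therefore
a proved corollary here, not a fact.  Computation drafted by the engine seat `p2-monsky-eng` (`RedeiReichardtDraft.lean`
@6f7c37f4, re-based on p319707); EVIDENCE (not a proof): eng's engines validate this orientation of `RM(D)` on 911 889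
class groups, and on all 50 276 square-free `n = p₁q₅ < 3·10⁶` the predicted members (`(p/q) = −1`: 25 488) are exactly
the rows with `r₄ = 0`.

## References

* [LiLiuTian2024] Y. Li, Y. Liu, Y. Tian, *On the Birch and Swinnerton-Dyer conjecture for CM elliptic curves over ℚ*,
  Thm. 1.2 (arXiv:1605.01481 p. 2).
* [LiMa2008] Y. Li, L. Ma, Acta Arith. 134 (2008), Lemma 0.1, Def. 0.2, Thm. 0.4 (Rédei–Reichardt).
* [IrelandRosen1990] K. Ireland, M. Rosen, GTM 84, Ch. 5 §2 Prop. 5.2.2 and Thm. 2 (Jacobi reciprocity).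
* [Miller2011LMS] R. L. Miller, *Proving the Birch and Swinnerton-Dyer conjecture for specific elliptic curves of
  analytic rank zero and one*, LMS J. Comput. Math. 14 (2011), Def. 1.1 (`BSD(E, p)`).
-/

open Matrix NumberField
open Literature.NumberTheory.EllipticCurves
open Literature.NumberTheory.EllipticCurves.Tian2014 (IsQuadraticFieldOfSqrt fourTwoCard)
open Literature.NumberTheory.QuadraticFields.RedeiReichardt

namespace Literature.NumberTheory.EllipticCurves.LiLiuTian2024.RedeiFamilies

/-! ### §1. Kronecker bits from residues (the entries of `RM(−4pq)`) -/

/-- For an odd prime `p ∤ a`: `kroneckerBit a p = 0 ⟺ (a/p) = +1` (the bit is `1` iff the symbol is `−1`, and the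
symbol is `±1`). [cite: IrelandRosen1990, Ch. 5 §1 Prop. 5.1.2 (Euler's criterion)] -/
theorem kroneckerBit_eq_zero_iff_jacobiSym {a : ℤ} {p : ℕ} (hp : p.Prime) (hp2 : p ≠ 2)
    (ha : (a : ZMod p) ≠ 0) : kroneckerBit a p = 0 ↔ jacobiSym a p = 1 := by
  haveI : Fact p.Prime := ⟨hp⟩
  have h01 : kroneckerBit a p = 0 ∨ kroneckerBit a p = 1 := by
    unfold kroneckerBit; split_ifs <;> simp
  have hpm : jacobiSym a p = 1 ∨ jacobiSym a p = -1 := by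
    rw [← jacobiSym.legendreSym.to_jacobiSym]
    exact legendreSym.eq_one_or_neg_one p ha
  have key := kroneckerBit_eq_one_iff_jacobiSym hp hp2 ha
  constructor
  · intro h0
    rcases hpm with h1 | h1
    · exact h1
    · exact absurd (key.mpr h1) (by rw [h0]; decide)
  · intro h1
    rcases h01 with h0 | h0
    · exact h0
    · have := key.mp h0
      omega

/-- A prime `r ≠ p` is nonzero in `ZMod p`. [cite: IrelandRosen1990, Ch. 5 §2 (definition of the Jacobi symbol)] -/
theorem natCast_ne_zero_of_prime_ne {p r : ℕ} (hp : p.Prime) (hr : r.Prime) (hne : r ≠ p) :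
    ((r : ℤ) : ZMod p) ≠ 0 := by
  rw [Int.cast_natCast, Ne, ZMod.natCast_eq_zero_iff]
  intro h
  exact hne ((Nat.prime_dvd_prime_iff_eq hp hr).mp h).symm

/-- `−4 ≠ 0` in `ZMod p` for an odd prime `p`. [cite: IrelandRosen1990, Ch. 5 §2 (definition of the Jacobi symbol)] -/
theorem neg_four_ne_zero {p : ℕ} (hp : p.Prime) (hp2 : p ≠ 2) : ((-4 : ℤ) : ZMod p) ≠ 0 := by
  intro h
  have h4 : ((4 : ℕ) : ZMod p) = 0 := by
    have : ((-4 : ℤ) : ZMod p) = -((4 : ℕ) : ZMod p) := by push_cast; ring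
    rw [this, neg_eq_zero] at h
    exact h
  rw [ZMod.natCast_eq_zero_iff] at h4
  have : p ∣ 2 ^ 2 := by simpa using h4
  exact hp2 ((Nat.prime_dvd_prime_iff_eq hp Nat.prime_two).mp (hp.dvd_of_dvd_pow this))

/-- `(−4/p) = +1` for a prime `p ≡ 1 (mod 4)`: `kroneckerBit (−4) p = 0`.
[cite: IrelandRosen1990, Ch. 5 §2 Prop. 5.2.2 ((−1/b) = (−1)^{(b−1)/2})] -/
theorem kroneckerBit_neg_four_eq_zero {p : ℕ} (hp : p.Prime) (hp4 : p % 4 = 1) :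
    kroneckerBit (-4) p = 0 := by
  have hp2 : p ≠ 2 := by omega
  rw [kroneckerBit_eq_zero_iff_jacobiSym hp hp2 (neg_four_ne_zero hp hp2)]
  have hodd : Odd p := Nat.odd_iff.mpr (by omega)
  have h1 : jacobiSym (-1) p = 1 := by
    rw [jacobiSym.at_neg_one hodd, ZMod.χ₄_nat_eq_if_mod_four]
    simp [hp4, show p % 2 = 1 by omega]
  have h2 : jacobiSym 4 p = 1 := by
    have hgcd : Int.gcd 2 p = 1 := by
      have h := Int.gcd_natCast_natCast 2 p
      rw [(Nat.coprime_primes Nat.prime_two hp).mpr (Ne.symm hp2)] at h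
      simpa using h
    have : (4 : ℤ) = 2 ^ 2 := by norm_num
    rw [this, jacobiSym.pow_left]
    exact jacobiSym.sq_one hgcd
  rw [show (-4 : ℤ) = -1 * 4 by norm_num, jacobiSym.mul_left, h1, h2, one_mul]

/-- `(r/2)`-bit of an odd prime discriminant `r ≡ 1 (mod 8)`: `0`. [cite: Cox2013, §5.B (definition of (D/2), before Prop. 5.16)] -/
theorem kroneckerBit_two_of_mod_eight_one {r : ℕ} (hr : r % 8 = 1) : kroneckerBit (r : ℤ) 2 = 0 := by
  rw [kroneckerBit_two, if_neg (by omega)]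

/-- `(r/2)`-bit of an odd prime discriminant `r ≡ 5 (mod 8)`: `1`. [cite: Cox2013, §5.B (definition of (D/2), before Prop. 5.16)] -/
theorem kroneckerBit_two_of_mod_eight_five {r : ℕ} (hr : r % 8 = 5) : kroneckerBit (r : ℤ) 2 = 1 := by
  rw [kroneckerBit_two, if_pos (by omega)]

/-! ### §2. The Rédei matrix of `ℚ(√−pq)`, `p ≡ 1 (mod 8)`, `q ≡ 5 (mod 8)` -/

section Family

variable {p q : ℕ}

/-- The prime discriminants of `D = −4pq`: `D₂ = −4`, `D_p = p`, `D_q = q`. [cite: LiMa2008, Lemma 0.1 (p. 279)] -/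
theorem primeDisc_p_mul_q (hp8 : p % 8 = 1) (hq8 : q % 8 = 5) :
    primeDisc (p * q) 2 = -4 ∧ primeDisc (p * q) p = p ∧ primeDisc (p * q) q = q := by
  have hp4 : p % 4 = 1 := by omega
  have hq4 : q % 4 = 1 := by omega
  have h4 : p * q % 4 = 1 := by rw [Nat.mul_mod, hp4, hq4]
  refine ⟨by simp [primeDisc, h4], ?_, ?_⟩
  · rw [primeDisc_of_ne_two _ (by omega), if_pos (by omega)]
  · rw [primeDisc_of_ne_two _ (by omega), if_pos (by omega)]

/-- **`RM(−4pq)` when `(p/q) = −1`**: `[[1,0,1],[0,1,1],[0,1,1]]` (rows `2, p, q`).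
[cite: LiMa2008, Def. 0.2 and Thm. 0.4 (pp. 279–280); evaluation ours] [cite: IrelandRosen1990, Ch. 5 §2 Thm. 2 (reciprocity)] -/
theorem redeiMatrix_two_p_q_of_jacobiSym_eq_neg_one (hp : p.Prime) (hq : q.Prime) (hp8 : p % 8 = 1)
    (hq8 : q % 8 = 5) (hpq : jacobiSym (p : ℤ) q = -1) :
    redeiMatrix (p * q) ![2, p, q] = !![1, 0, 1; 0, 1, 1; 0, 1, 1] := by
  obtain ⟨d2, dp, dq⟩ := primeDisc_p_mul_q hp8 hq8
  have hne : p ≠ q := by omega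
  have hqp : jacobiSym (q : ℤ) p = -1 := by
    rw [jacobiSym.quadratic_reciprocity_one_mod_four (by omega) (Nat.odd_iff.mpr (by omega))]; exact hpq
  have e02 : kroneckerBit (p : ℤ) 2 = 0 := kroneckerBit_two_of_mod_eight_one hp8
  have e03 : kroneckerBit (q : ℤ) 2 = 1 := kroneckerBit_two_of_mod_eight_five hq8
  have e10 : kroneckerBit (-4) p = 0 := kroneckerBit_neg_four_eq_zero hp (by omega)
  have e20 : kroneckerBit (-4) q = 0 := kroneckerBit_neg_four_eq_zero hq (by omega)
  have e12 : kroneckerBit (q : ℤ) p = 1 :=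
    (kroneckerBit_eq_one_iff_jacobiSym hp (by omega) (natCast_ne_zero_of_prime_ne hp hq hne.symm)).mpr hqp
  have e21 : kroneckerBit (p : ℤ) q = 1 :=
    (kroneckerBit_eq_one_iff_jacobiSym hq (by omega) (natCast_ne_zero_of_prime_ne hq hp hne)).mpr hpq
  ext i j
  fin_cases i <;> fin_cases j <;>
    simp [redeiMatrix, Finset.sum_erase_eq_sub, Fin.sum_univ_three, d2, dp, dq, e02, e03, e10, e20,
      e12, e21]

/-- **`RM(−4pq)` when `(p/q) = +1`**: `[[1,0,1],[0,0,0],[0,0,0]]`.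
[cite: LiMa2008, Def. 0.2 and Thm. 0.4 (pp. 279–280); evaluation ours] [cite: IrelandRosen1990, Ch. 5 §2 Thm. 2 (reciprocity)] -/
theorem redeiMatrix_two_p_q_of_jacobiSym_eq_one (hp : p.Prime) (hq : q.Prime) (hp8 : p % 8 = 1)
    (hq8 : q % 8 = 5) (hpq : jacobiSym (p : ℤ) q = 1) :
    redeiMatrix (p * q) ![2, p, q] = !![1, 0, 1; 0, 0, 0; 0, 0, 0] := by
  obtain ⟨d2, dp, dq⟩ := primeDisc_p_mul_q hp8 hq8
  have hne : p ≠ q := by omega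
  have hqp : jacobiSym (q : ℤ) p = 1 := by
    rw [jacobiSym.quadratic_reciprocity_one_mod_four (by omega) (Nat.odd_iff.mpr (by omega))]; exact hpq
  have e02 : kroneckerBit (p : ℤ) 2 = 0 := kroneckerBit_two_of_mod_eight_one hp8
  have e03 : kroneckerBit (q : ℤ) 2 = 1 := kroneckerBit_two_of_mod_eight_five hq8
  have e10 : kroneckerBit (-4) p = 0 := kroneckerBit_neg_four_eq_zero hp (by omega)
  have e20 : kroneckerBit (-4) q = 0 := kroneckerBit_neg_four_eq_zero hq (by omega)
  have e12 : kroneckerBit (q : ℤ) p = 0 :=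
    (kroneckerBit_eq_zero_iff_jacobiSym hp (by omega) (natCast_ne_zero_of_prime_ne hp hq hne.symm)).mpr hqp
  have e21 : kroneckerBit (p : ℤ) q = 0 :=
    (kroneckerBit_eq_zero_iff_jacobiSym hq (by omega) (natCast_ne_zero_of_prime_ne hq hp hne)).mpr hpq
  ext i j
  fin_cases i <;> fin_cases j <;>
    simp [redeiMatrix, Finset.sum_erase_eq_sub, Fin.sum_univ_three, d2, dp, dq, e02, e03, e10, e20,
      e12, e21]

/-- Kernel count `2` (`rank RM = 2 = t − 1`, `r₄ = 0`) when `(p/q) = −1`. [cite: LiMa2008, Thm. 0.4 (p. 280)] -/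
theorem card_ker_redeiMatrix_two_p_q_of_jacobiSym_eq_neg_one (hp : p.Prime) (hq : q.Prime)
    (hp8 : p % 8 = 1) (hq8 : q % 8 = 5) (hpq : jacobiSym (p : ℤ) q = -1) :
    Fintype.card {v : Fin 3 → ZMod 2 // redeiMatrix (p * q) ![2, p, q] *ᵥ v = 0} = 2 := by
  have hM := redeiMatrix_two_p_q_of_jacobiSym_eq_neg_one hp hq hp8 hq8 hpq
  rw [Fintype.card_congr (Equiv.subtypeEquivRight
    (q := fun v : Fin 3 → ZMod 2 => (!![1, 0, 1; 0, 1, 1; 0, 1, 1] : Matrix (Fin 3) (Fin 3) (ZMod 2)) *ᵥ v = 0)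
    (fun v => by rw [hM]))]
  decide

/-- Kernel count `4` (`rank RM = 1`, `r₄ = 1`) when `(p/q) = +1`. [cite: LiMa2008, Thm. 0.4 (p. 280)] -/
theorem card_ker_redeiMatrix_two_p_q_of_jacobiSym_eq_one (hp : p.Prime) (hq : q.Prime)
    (hp8 : p % 8 = 1) (hq8 : q % 8 = 5) (hpq : jacobiSym (p : ℤ) q = 1) :
    Fintype.card {v : Fin 3 → ZMod 2 // redeiMatrix (p * q) ![2, p, q] *ᵥ v = 0} = 4 := by
  have hM := redeiMatrix_two_p_q_of_jacobiSym_eq_one hp hq hp8 hq8 hpq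
  rw [Fintype.card_congr (Equiv.subtypeEquivRight
    (q := fun v : Fin 3 → ZMod 2 => (!![1, 0, 1; 0, 0, 0; 0, 0, 0] : Matrix (Fin 3) (Fin 3) (ZMod 2)) *ᵥ v = 0)
    (fun v => by rw [hM]))]
  decide

/-- The side conditions of the Rédei door for the tuple `(2, p, q)`: primes, injective, `∏ = 2pq` with
`pq ≡ 1 (mod 4)`. [cite: LiMa2008, Lemma 0.1 (p. 279)] -/
theorem redei_side_conditions (hp : p.Prime) (hq : q.Prime) (hp8 : p % 8 = 1) (hq8 : q % 8 = 5) :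
    (∀ i, ((![2, p, q] : Fin 3 → ℕ) i).Prime) ∧ Function.Injective (![2, p, q] : Fin 3 → ℕ) ∧
      (∏ i, (![2, p, q] : Fin 3 → ℕ) i) = if (p * q) % 4 = 1 then 2 * (p * q) else p * q := by
  have hp4 : p % 4 = 1 := by omega
  have hq4 : q % 4 = 1 := by omega
  have h4 : p * q % 4 = 1 := by rw [Nat.mul_mod, hp4, hq4]
  refine ⟨?_, ?_, ?_⟩
  · intro i; fin_cases i
    · exact Nat.prime_two
    · exact hp
    · exact hq
  · intro i j h
    have : p ≠ q := by omega
    have : p ≠ 2 := by omega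
    have : q ≠ 2 := by omega
    fin_cases i <;> fin_cases j <;> simp_all
  · rw [if_pos h4, Fin.prod_univ_three]
    simp; ring

/-- **`(p/q) = −1 ⟹ ℚ(√−pq)` has no ideal class of order `4`** (`p ≡ 1`, `q ≡ 5 (mod 8)` primes), modulo
Rédei–Reichardt — the class-group hypothesis of Li–Liu–Tian Thm. 1.2 for the whole family.
[cite: LiMa2008, Thm. 0.4 (p. 280); evaluation ours] [cite: LiLiuTian2024, Thm. 1.2 (hypothesis)] -/
theorem noIdealClassOfOrderFour_neg_p_mul_q (h : redeiReichardt_fourTwoCard_classGroup) (hp : p.Prime)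
    (hq : q.Prime) (hp8 : p % 8 = 1) (hq8 : q % 8 = 5) (hpq : jacobiSym (p : ℤ) q = -1) :
    NoIdealClassOfOrderFour (-((p * q : ℕ) : ℤ)) := by
  obtain ⟨hpr, hinj, hprod⟩ := redei_side_conditions hp hq hp8 hq8
  exact noIdealClassOfOrderFour_of_card_ker h hpr hinj hprod
    (card_ker_redeiMatrix_two_p_q_of_jacobiSym_eq_neg_one hp hq hp8 hq8 hpq)

/-- **`(p/q) = +1 ⟹ r₄(Cl(ℚ(√−pq))) = 1`** (`#(Cl² ∩ Cl[2]) = 2`): these `n = pq` lie OUTSIDE Li–Liu–Tian's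
family (there is an ideal class of order `4`), modulo Rédei–Reichardt. [cite: LiMa2008, Thm. 0.4 (p. 280); evaluation ours] -/
theorem fourTwoCard_eq_two_neg_p_mul_q (h : redeiReichardt_fourTwoCard_classGroup) (hp : p.Prime)
    (hq : q.Prime) (hp8 : p % 8 = 1) (hq8 : q % 8 = 5) (hpq : jacobiSym (p : ℤ) q = 1)
    (K : Type) [Field K] [NumberField K] (hK : IsQuadraticFieldOfSqrt K (-((p * q : ℕ) : ℤ))) :
    fourTwoCard (ClassGroup (𝓞 K)) = 2 := by
  obtain ⟨hpr, hinj, hprod⟩ := redei_side_conditions hp hq hp8 hq8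
  exact fourTwoCard_eq_two_of_card_ker h hpr hinj hprod
    (card_ker_redeiMatrix_two_p_q_of_jacobiSym_eq_one hp hq hp8 hq8 hpq) K hK

/-! ### §3. Li–Liu–Tian Thm. 1.2 on the family (modulo the two named facts) -/

/-- `pq` is square-free, `≡ 5 (mod 8)`, with prime factors `≡ 1 (mod 4)`. [cite: LiLiuTian2024, Thm. 1.2 (hypotheses)] -/
theorem thm12_hypotheses_p_mul_q (hp : p.Prime) (hq : q.Prime) (hp8 : p % 8 = 1) (hq8 : q % 8 = 5) :
    Squarefree (p * q) ∧ p * q % 8 = 5 ∧ ∀ r : ℕ, r.Prime → r ∣ p * q → r % 4 = 1 := by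
  refine ⟨(Nat.squarefree_mul ((Nat.coprime_primes hp hq).mpr (by omega))).mpr
    ⟨hp.squarefree, hq.squarefree⟩, by rw [Nat.mul_mod, hp8, hq8], fun r hr hdvd => ?_⟩
  rcases (Nat.Prime.dvd_mul hr).mp hdvd with h | h
  · rw [(Nat.prime_dvd_prime_iff_eq hr hp).mp h]; omega
  · rw [(Nat.prime_dvd_prime_iff_eq hr hq).mp h]; omega

/-- **Rank one and RANK ∧ SHAFIN ∧ LEAD for `E_{pq}`**, `p ≡ 1 (mod 8)`, `q ≡ 5 (mod 8)`, `(p/q) = −1`, modulo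
Rédei–Reichardt and Li–Liu–Tian Thm. 1.2: `rank E_{pq}(ℚ) = 1 = ord_{s=1} L(E_{pq}, s)` and `BSDTriple`.
[cite: LiLiuTian2024, Thm. 1.2] [cite: LiMa2008, Thm. 0.4 (p. 280)] -/
theorem bsd_congruentNumberCurve_p_mul_q (hR : redeiReichardt_fourTwoCard_classGroup)
    (h12 : thm12_bsd_congruentNumberCurve) (hp : p.Prime) (hq : q.Prime) (hp8 : p % 8 = 1)
    (hq8 : q % 8 = 5) (hpq : jacobiSym (p : ℤ) q = -1) :
    haveI := isElliptic_congruentNumberCurve (Squarefree.ne_zero (thm12_hypotheses_p_mul_q hp hq hp8 hq8).1)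
    haveI := isGloballyMinimal_congruentNumberCurve (thm12_hypotheses_p_mul_q hp hq hp8 hq8).1
    (congruentNumberCurve (p * q)).mordellWeilRank = 1 ∧ (congruentNumberCurve (p * q)).analyticRank = 1 ∧
      (congruentNumberCurve (p * q)).BSDTriple := by
  obtain ⟨hsq, h8, hfac⟩ := thm12_hypotheses_p_mul_q hp hq hp8 hq8
  exact bsd_congruentNumberCurve_of_thm12 h12 hsq h8 hfac
    (noIdealClassOfOrderFour_neg_p_mul_q hR hp hq hp8 hq8 hpq)

/-- **`BSD(E_{pq}, ℓ)` for EVERY prime `ℓ`** on the family `p ≡ 1 (mod 8)`, `q ≡ 5 (mod 8)`, `(p/q) = −1`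
(Miller's `BSD(E, p)`), modulo Rédei–Reichardt and Li–Liu–Tian Thm. 1.2 — uniformly in the primes.
[cite: LiLiuTian2024, Thm. 1.2] [cite: LiMa2008, Thm. 0.4 (p. 280)] [cite: Miller2011LMS, §1 and Def. 1.1] -/
theorem forall_bsdp_congruentNumberCurve_p_mul_q (hR : redeiReichardt_fourTwoCard_classGroup)
    (h12 : thm12_bsd_congruentNumberCurve) (hp : p.Prime) (hq : q.Prime) (hp8 : p % 8 = 1)
    (hq8 : q % 8 = 5) (hpq : jacobiSym (p : ℤ) q = -1) (ℓ : ℕ) (hℓ : ℓ.Prime) :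
    haveI := isElliptic_congruentNumberCurve (Squarefree.ne_zero (thm12_hypotheses_p_mul_q hp hq hp8 hq8).1)
    haveI := isGloballyMinimal_congruentNumberCurve (thm12_hypotheses_p_mul_q hp hq hp8 hq8).1
    BSDp (congruentNumberCurve (p * q)) ℓ := by
  obtain ⟨hsq, h8, hfac⟩ := thm12_hypotheses_p_mul_q hp hq hp8 hq8
  haveI := isElliptic_congruentNumberCurve (Squarefree.ne_zero hsq)
  haveI := isGloballyMinimal_congruentNumberCurve hsq
  exact forall_bsdp_congruentNumberCurve_of_thm12 h12 hsq h8 hfac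
    (noIdealClassOfOrderFour_neg_p_mul_q hR hp hq hp8 hq8 hpq) ℓ hℓ

/-- **Showcase symbols**: `85 = 17·5` has `(17/5) = (2/5) = −1` (a member — the smallest composite one, in
accordance with `RedeiReichardt.noIdealClassOfOrderFour_neg85`), while `205 = 41·5` has `(41/5) = (1/5) = +1`
(not a member: `r₄(Cl(ℚ(√−205))) = 1`).
[cite: LiLiuTian2024, Thm. 1.2] [cite: IrelandRosen1990, Ch. 5 §2 (Jacobi symbol values)] -/
theorem jacobiSym_seventeen_five_and_fortyOne_five :
    jacobiSym 17 5 = -1 ∧ jacobiSym 41 5 = 1 := by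
  constructor <;> norm_num

/-- `BSD(E₈₅, ℓ)` for every prime `ℓ` from the UNIFORM family theorem (`85 = 17·5`, `(17/5) = −1`), modulo the
two facts. [cite: LiLiuTian2024, Thm. 1.2] [cite: Miller2011LMS, Def. 1.1] -/
theorem forall_bsdp_congruentNumberCurve_eightyFive (hR : redeiReichardt_fourTwoCard_classGroup)
    (h12 : thm12_bsd_congruentNumberCurve) (ℓ : ℕ) (hℓ : ℓ.Prime) :
    haveI := isElliptic_congruentNumberCurve (n := 85) (by norm_num)
    haveI := isGloballyMinimal_congruentNumberCurve (n := 85)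
      (thm12_hypotheses_p_mul_q (p := 17) (q := 5) (by norm_num) (by norm_num) (by norm_num) (by norm_num)).1
    BSDp (congruentNumberCurve 85) ℓ :=
  forall_bsdp_congruentNumberCurve_p_mul_q (p := 17) (q := 5) hR h12 (by norm_num) (by norm_num)
    (by norm_num) (by norm_num) (by norm_num) ℓ hℓ

end Family

end Literature.NumberTheory.EllipticCurves.LiLiuTian2024.RedeiFamilies
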